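import Summits.QuantumFields.YangMills.Theorems.BalabanUVNodesN12AtRecord12Pointed
import Literature.MathematicalPhysics.QuantumFieldTheory.Balaban1983to89.Node00.Record12LiveSelector
import Literature.MathematicalPhysics.QuantumFieldTheory.Balaban1983to89.Node00.Record12PresentSlots

/-!
# BalabanUVNodes ∕ N12 AT THE LIVE SELECTOR OF RECORD — on node00-def-K0a's live re-pin `θ.liveRepin` (director-ym LINE №114 (α)) N12's fibre-witness display is FREE and its
# mass display READS «every LIVE pre-𝐑 term has positive mass»; N12's pointed row ∕ the `NodesAtSomeRecord12` body ON THE K0′ WITNESS LINE `θ₀ˡⁱᵛᵉ`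
# (sequel of `BalabanUVNodesN12AtRecord12Pointed`; Track A, DAG node N12 = [B15, Balaban1989LargeFieldI] CMP 122 (1989) 175; cluster K1′ `StabilityBAtRecordR12e` =
# stmt-QuantumFields-19903 (rev 15); seat `pub-ymgap-dag-n12-d` g4 (R134 s2, HANDOFF trigger t5), 2026-08-27; count-neutral, NOT a discharge)
HONEST FRAMING.  Count-neutral kernel BOOKKEEPING BY NAME; nothing of Bałaban's asserted; `Provisos₁₂` at the re-pinned witness NOT claimed (K0′); N12 NOT discharged.
WHY THIS FILE.  Every N12 closer of this seat carries [IV] p.176 ll.14–16 («the densities are positive … hence the denominators are positive») as TWO displays on the record's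
`p–p′` selector: `hmassSel : ∀ s, 0 < ∫dV t_{ppSel s}` and the fibre witness `hfib : ∀ s, ∃ s′, ppSel s′ = ppSel s ∧ 0 < ∫dV t_{s′}`.  node00-def-K0a's `Node00/Record12LiveSelector`
RE-PINS the selector of a Stage-12 parameter to the LIVE SELECTOR OF RECORD (`Stage12Params.liveRepin`; the K0′ witness becomes `theta12LiveOfRecord = (theta12OfRecord …).liveRepin`):
identity on the LIVE sequences of the pre-𝐑 family (`LiveSeq`), every other sequence sent to one live sequence.  There:
* §1 (generic, at K0a's objects) the live selector is IDEMPOTENT (`liveSelOfSlot_idem`, `ppSelLiveOfRecord_succ_idem`); K0b's liveness body «`f s V ≠ 0 ∧ ∫⌈_{Z′(s)} t_s (V) ≠ 0`»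
  gives K0a's `LiveSeq` (`liveSeq_of_ne_zero`, K0b's `rstepOfSel_TexpA_eq_zero_iff_of_sel_self` at `sel := id`); with one live sequence, «positive mass at every selected term»
  ⟺ «positive mass at every LIVE term» (`forall_mass_pos_ppSelLive_iff`).
* §2 (Stage-9 generic) N12's mass display sits ON K0′'s row-P12 objects: below the torus a pre-𝐑 term with positive mass is LIVE (`liveSeq_of_mass_pos`: K0b's fibre-Fubini
  `exists_ne_zero_and_fibreIntegral_ne_zero` + `Provisos₁₀.rstep`), so `hmassSel` makes every range point of `θ.ppSel P g (k+1)` live (`forall_liveSeq_ppSel_of_massSel`).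
* §3 AT THE LIVE RE-PIN `(Θ.liveRepin).toStage9Params`: `hfib` is FREE (`fibreWitness_liveRepin_of_massSel`, dag-n12-e's `fibreWitness_of_idem`); below the torus, with the Stage-10
  provisos AT THE RE-PIN (displayed — they read the selector), `hmassSel` ⟺ «every live pre-𝐑 term has positive mass» (`massSel_liveRepin_iff`; a live sequence from K0b's
  `exists_live_slotsTOfRecord_succ_rterm`); the [IV] leaf at `λ⁴` and N12's pointed row at the re-pin's bundle of record with `hfib` dropped ∕ on the live-mass proviso.
* §4 ON THE K0′ WITNESS LINE `θ₀ˡⁱᵛᵉ := theta12LiveOfRecord F N ζ Rz Zt`: the non-vacuity of the (1.80) ∕ (1.89) displays with admissibility DISCHARGED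
  (`admissible_theta12LiveOfRecord`; window `]0, ½]`) and N12's pointed row at `θ₀ˡⁱᵛᵉ.pinW (bundle of record)` below the torus on the live-mass proviso.
* §5 module 1's `NodesAtSomeRecord12` body AT A LIVE RE-PIN `Θ.liveRepin`, N12 read at the bundle of record: admissibility ∕ partition of unity are Θ's (K0a's transports),
  `SlotsNondegenerate` (= per-level liveness; beyond the torus LINE №118's guard pending) and `Provisos₁₂` at the re-pin DISPLAYED (K0′), other rows as module 27, `hfib` GONE.
WHAT N12 THEN COSTS on the witness line (typing strength, NOT a second gap): `Provisos₁₂ θ₀ˡⁱᵛᵉ` and per-level liveness (K0′'s open rows), `hdeg`, positive mass of the LIVE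
pre-𝐑 terms below the torus (NODE 00 — the measure-theoretic residue of p.176 ll.14–16), Prop. 1 at `λ.LF P` (dag-n12-c), (1.80) + (1.89) at the pinned letters (dag-n12-e), σ's regions
residual.  One finite four-torus programme at fixed `ε`; nothing continuum ∕ ℝ⁴ ∕ OS ∕ mass gap ∕ Clay.  0 `sorry`, 0 `def`, standard axioms.  Filed `--supports` K1′ (19903) `--as helper`.
Sources: [Balaban1989LargeFieldI] (0.2)–(0.6) pp.176–177, Prop. 1 p.194, (1.80), (1.89); [Balaban1988Convergent] (2.18), (3.22)–(3.25); [Balaban1989LargeFieldII] Thm 1 + (0.1).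
-/

noncomputable section

open MeasureTheory
open scoped Matrix.Norms.L2Operator

namespace Summit.QuantumFields.YangMills.BalabanUVNodes.N12AtRecord12LiveSelector
open Literature.MathematicalPhysics.QuantumFieldTheory.Balaban1983to89
open Literature.MathematicalPhysics.QuantumFieldTheory.Balaban1983to89.T4Continuum (T4Family)
open Literature.MathematicalPhysics.QuantumFieldTheory.Balaban1983to89.DagBinding (WorldP leavesP PrintedCarriersR PrintedCarriers15 B15Leaf B8LeafR B9LeafX B11Leaf Nodes)
open Literature.MathematicalPhysics.QuantumFieldTheory.Balaban1983to89.Node00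
open B15Claim189Assembly (new189 chiPP dom)
open B15DeterminingSets (MSField)
open B15 (Prop1Printed Ineq180)
open B15.BasicStep (Claim189 fibreIntegral)
open B8Eq17ClassAkV1 (plaqsOf)
open B15LeafKnitMassSel (fibreWitness_of_idem)
open Summit.QuantumFields.YangMills.BalabanUVNodes.N12AtRecord12Pointed
  (b15Leaf_WOfRecord₁₀_pinAllχ₀_of_deg_massSel new189_pinAllχ₀_one_zero₁₂ nodesAtSomeRecord₁₂_of_pointed_pinW)

variable {N : ℕ} [NeZero N] {F : T4Family}
/-! ## §1 GENERIC, AT K0a's OBJECTS — the live selector is idempotent; K0b's liveness body gives `LiveSeq`; mass at selected ⟺ mass at live terms -/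

section Generic
variable {ν : Stage7Numerics} {τ : TowerNumerics} {p : B12.RunParams} {g : ℕ → ℝ} {k : ℕ}

/-- **THE LIVE SELECTOR OF A SLOT FAMILY IS IDEMPOTENT** (print's `(Z″)″ = Z″`, p. 177): its values are live (K0a's `liveSeq_liveSelOfSlot`) hence fixed (`liveSelOfSlot_of_live`);
with no live sequence it is the identity. [cite: Balaban1989LargeFieldI, (0.3) p.176, p.177 (the selection of `Z″`)] -/
theorem liveSelOfSlot_idem (f : TexpASlot F N ν τ.M p g k) (s : SeqOfRecord F ν τ.M g p.K k) :
    liveSelOfSlot F N ν τ p g k f (liveSelOfSlot F N ν τ p g k f s) = liveSelOfSlot F N ν τ p g k f s := by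
  by_cases h : ∃ s', LiveSeq F N ν τ p g k f s'
  · exact liveSelOfSlot_of_live F N (liveSeq_liveSelOfSlot F N h s)
  · rw [liveSelOfSlot_of_none F N h]

/-- **K0b's LIVENESS BODY GIVES K0a's `LiveSeq`**: a configuration with `f s V ≠ 0` and `∫⌈_{Z′(s)} t_s (V) ≠ 0` (`t_s = χ_k(s)·f(s)`, def-R's `rterm` of the slice) makes `s` live —
at the identity selector the 𝐑-stepped slot vanishes iff the slot does (K0b's `rstepOfSel_TexpA_eq_zero_iff_of_sel_self`, `sel := id`; the restricted integral's `DecidableEq`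
instance bridged by `convert`). [cite: Balaban1989LargeFieldI, (0.3) p.176; Balaban1988Convergent, (2.18) p.257] -/
theorem liveSeq_of_ne_zero (f : TexpASlot F N ν τ.M p g k) (s : SeqOfRecord F ν τ.M g p.K k) {V : GaugeField (F.P p.K) k (SU N)}
    (hT : f s V ≠ 0) (hI : fibreIntegral (fibOfSeq F ν τ p g k s) (rterm (sliceOfRecord F N ν τ.M p g k f) s) V ≠ 0) :
    LiveSeq F N ν τ p g k f s := by
  refine ⟨V, ?_⟩
  unfold rstepSlot
  intro h0
  refine hT ((rstepOfSel_TexpA_eq_zero_iff_of_sel_self (sliceOfRecord F N ν τ.M p g k f) id (fibOfSeq F ν τ p g k) s rfl V ?_).1 h0)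
  convert hI using 2

end Generic

section LiveRecord
variable {ν : Stage7Numerics} {τ : TowerNumerics} (E : B12.RunParams → ℝ) (w : StepWeightsOfRecord F N ν τ.M) (p : B12.RunParams) (g : ℕ → ℝ) (k : ℕ)

/-- The live selector OF RECORD at a positive level is idempotent. [cite: Balaban1989LargeFieldI, (0.3) p.176, p.177] -/
theorem ppSelLiveOfRecord_succ_idem (s : SeqOfRecord F ν τ.M g p.K (k + 1)) :
    ppSelLiveOfRecord F N ν τ E w p g (k + 1) (ppSelLiveOfRecord F N ν τ E w p g (k + 1) s) = ppSelLiveOfRecord F N ν τ E w p g (k + 1) s :=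
  liveSelOfSlot_idem _ s

/-- A live sequence of the pre-𝐑 family is FIXED by the live selector of record (K0a's `ppSelLiveOfRecord_succ_eq` + `liveSelOfSlot_of_live`).
[cite: Balaban1989LargeFieldI, (0.3) p.176 (bookkeeping)] -/
theorem ppSelLiveOfRecord_succ_of_live {s : SeqOfRecord F ν τ.M g p.K (k + 1)}
    (hs : LiveSeq F N ν τ p g (k + 1) (slotsTOfRecord F N ν τ E w (ppSelLiveOfRecord F N ν τ E w) p g (k + 1)) s) :
    ppSelLiveOfRecord F N ν τ E w p g (k + 1) s = s := by
  rw [ppSelLiveOfRecord_succ_eq]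
  exact liveSelOfSlot_of_live F N hs

/-- Every value of the live selector of record is live, once some sequence is. [cite: Balaban1989LargeFieldI, (0.3) p.176 (bookkeeping)] -/
theorem liveSeq_ppSelLiveOfRecord_succ
    (hex : ∃ s, LiveSeq F N ν τ p g (k + 1) (slotsTOfRecord F N ν τ E w (ppSelLiveOfRecord F N ν τ E w) p g (k + 1)) s)
    (s : SeqOfRecord F ν τ.M g p.K (k + 1)) :
    LiveSeq F N ν τ p g (k + 1) (slotsTOfRecord F N ν τ E w (ppSelLiveOfRecord F N ν τ E w) p g (k + 1)) (ppSelLiveOfRecord F N ν τ E w p g (k + 1) s) := by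
  rw [ppSelLiveOfRecord_succ_eq]
  exact liveSeq_liveSelOfSlot F N hex s

/-- **AT THE LIVE SELECTOR OF RECORD, «positive mass of every SELECTED term» ⟺ «positive mass of every LIVE term»** (any piece family, any measure; one live sequence
needed for `←`). [cite: Balaban1989LargeFieldI, (0.3) p.176, p.176 ll.14–16 (bookkeeping)] -/
theorem forall_mass_pos_ppSelLive_iff
    (hex : ∃ s, LiveSeq F N ν τ p g (k + 1) (slotsTOfRecord F N ν τ E w (ppSelLiveOfRecord F N ν τ E w) p g (k + 1)) s)
    (μ : Measure (GaugeField (F.P p.K) (k + 1) (SU N))) (piece : SeqOfRecord F ν τ.M g p.K (k + 1) → Density (F.P p.K) (k + 1) (SU N)) :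
    (∀ s, 0 < ∫ V, piece (ppSelLiveOfRecord F N ν τ E w p g (k + 1) s) V ∂μ) ↔
      ∀ s, LiveSeq F N ν τ p g (k + 1) (slotsTOfRecord F N ν τ E w (ppSelLiveOfRecord F N ν τ E w) p g (k + 1)) s → 0 < ∫ V, piece s V ∂μ := by
  rw [ppSelLiveOfRecord_succ_eq]
  constructor
  · intro h s hs
    have := h s
    rwa [liveSelOfSlot_of_live F N hs] at this
  · intro h s
    exact h _ (liveSeq_liveSelOfSlot F N hex s)

end LiveRecord

/-! ## §2 STAGE-9 GENERIC — N12's mass display sits on K0′'s row-P12 objects -/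

section Mass
variable (θ : Stage9Params F N)

/-- **BELOW THE TORUS A PRE-𝐑 TERM WITH POSITIVE MASS IS LIVE**: at step `k < K` the term `t_s = χ_{k+1}(s)·(𝐓e^A)(s)` of `Tstep rep_k` is measurable, `≥ 0` and bounded
(`Provisos₁₀.rstep`), so `0 < ∫dV t_s` puts a configuration where `(𝐓e^A)(s)` and `∫⌈_{Z′(s)} t_s` are both non-zero (K0b's `exists_ne_zero_and_fibreIntegral_ne_zero`).
[cite: Balaban1989LargeFieldI, (0.2)–(0.3) p.176, p.176 ll.14–16; Balaban1988Convergent, (2.18) p.257, (3.25) p.270] -/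
theorem liveSeq_of_mass_pos (hP : θ.Provisos₁₀) (P : B12.RunParams) {k : ℕ} (hk : k < P.K)
    (s : SeqOfRecord F θ.ν θ.τ9.M (gOfRecord₁₀ F N θ P) P.K (k + 1))
    (hmass : 0 < ∫ V, rterm (repTOfRecord9 F N θ.ν θ.τ9 (EOfRecord₁₀ F N θ) (wOfRecord₉ F N θ) θ.ppSel P (gOfRecord₁₀ F N θ P) k) s V
      ∂(fieldMeasure (F.P P.K) (k + 1) (SU N))) :
    LiveSeq F N θ.ν θ.τ9 P (gOfRecord₁₀ F N θ P) (k + 1)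
      (slotsTOfRecord F N θ.ν θ.τ9 (EOfRecord₁₀ F N θ) (wOfRecord₉ F N θ) θ.ppSel P (gOfRecord₁₀ F N θ P) (k + 1)) s := by
  obtain ⟨hm, h0, ⟨C, hC⟩, -⟩ := hP.rstep P k hk
  obtain ⟨V, htV, hFV⟩ := exists_ne_zero_and_fibreIntegral_ne_zero
    (t := rterm (sliceOfRecord F N θ.ν θ.τ9.M P (gOfRecord₁₀ F N θ P) (k + 1)
      (slotsTOfRecord F N θ.ν θ.τ9 (EOfRecord₁₀ F N θ) (wOfRecord₉ F N θ) θ.ppSel P (gOfRecord₁₀ F N θ P) (k + 1))) s)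
    (fibOfSeq F θ.ν θ.τ9 P (gOfRecord₁₀ F N θ P) (k + 1) s) (hm s) (h0 s) (hC s) hmass.ne'
  exact liveSeq_of_ne_zero _ s (mul_ne_zero_iff.1 htV).2 hFV

/-- **… SO N12's MASS DISPLAY MAKES EVERY RANGE POINT OF THE SELECTOR LIVE**: `hmassSel` at (θ, P, k < K) ⇒ every `ppSel s` is live — the display is at least K0′'s row P12
ON THE SELECTOR'S RANGE (whatever the selector). [cite: Balaban1989LargeFieldI, (0.3) p.176, p.176 ll.14–16; Balaban1988Convergent, (3.22) p.269 (bookkeeping)] -/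
theorem forall_liveSeq_ppSel_of_massSel (hP : θ.Provisos₁₀) (P : B12.RunParams) {k : ℕ} (hk : k < P.K)
    (hmassSel : ∀ s, 0 < ∫ V, rterm (repTOfRecord9 F N θ.ν θ.τ9 (EOfRecord₁₀ F N θ) (wOfRecord₉ F N θ) θ.ppSel P (gOfRecord₁₀ F N θ P) k)
      (θ.ppSel P (gOfRecord₁₀ F N θ P) (k + 1) s) V ∂(fieldMeasure (F.P P.K) (k + 1) (SU N))) :
    ∀ s, LiveSeq F N θ.ν θ.τ9 P (gOfRecord₁₀ F N θ P) (k + 1)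
      (slotsTOfRecord F N θ.ν θ.τ9 (EOfRecord₁₀ F N θ) (wOfRecord₉ F N θ) θ.ppSel P (gOfRecord₁₀ F N θ P) (k + 1)) (θ.ppSel P (gOfRecord₁₀ F N θ P) (k + 1) s) :=
  fun s => liveSeq_of_mass_pos θ hP P hk _ (hmassSel s)

end Mass

/-! ## §3 AT THE LIVE RE-PIN `(Θ.liveRepin).toStage9Params` — `hfib` FREE; below the torus `hmassSel` ⟺ positive mass of the LIVE terms; N12's leaf and pointed row -/

section Repin
variable (Θ : Stage12Params F N)

/-- The live re-pin's selector at a positive level is idempotent (K0a's `liveRepin_ppSel` is `ppSelLiveOfRecord`, definitionally). [cite: Balaban1989LargeFieldI, (0.3) p.176, p.177] -/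
theorem ppSel_liveRepin_succ_idem (P : B12.RunParams) (g : ℕ → ℝ) (k : ℕ) (s : SeqOfRecord F Θ.ν Θ.τ9.M g P.K (k + 1)) :
    (Θ.liveRepin F N).ppSel P g (k + 1) ((Θ.liveRepin F N).ppSel P g (k + 1) s) = (Θ.liveRepin F N).ppSel P g (k + 1) s :=
  liveSelOfSlot_idem _ s

variable (lam : ResidW F N)

/-- **AT THE LIVE RE-PIN N12's FIBRE-WITNESS DISPLAY IS FREE**: `hfib` follows from `hmassSel` (dag-n12-e's `fibreWitness_of_idem` at the idempotent live selector), every run,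
every step. [cite: Balaban1989LargeFieldI, (0.3) p.176, p.177 (`(Z″)″ = Z″`)] -/
theorem fibreWitness_liveRepin_of_massSel (P : B12.RunParams)
    (hmassSel : ∀ s, 0 < ∫ V, rterm (repTOfRecord9 F N Θ.ν Θ.τ9 (EOfRecord₁₀ F N (Θ.liveRepin F N).toStage9Params)
        (wOfRecord₉ F N (Θ.liveRepin F N).toStage9Params) (Θ.liveRepin F N).ppSel P (gOfRecord₁₀ F N (Θ.liveRepin F N).toStage9Params P) (lam.kSel P))
        ((Θ.liveRepin F N).ppSel P (gOfRecord₁₀ F N (Θ.liveRepin F N).toStage9Params P) (lam.kSel P + 1) s) V ∂(fieldMeasure (F.P P.K) (lam.kSel P + 1) (SU N))) :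
    ∀ s, ∃ s', (Θ.liveRepin F N).ppSel P (gOfRecord₁₀ F N (Θ.liveRepin F N).toStage9Params P) (lam.kSel P + 1) s'
        = (Θ.liveRepin F N).ppSel P (gOfRecord₁₀ F N (Θ.liveRepin F N).toStage9Params P) (lam.kSel P + 1) s ∧
      0 < ∫ V, rterm (repTOfRecord9 F N Θ.ν Θ.τ9 (EOfRecord₁₀ F N (Θ.liveRepin F N).toStage9Params)
        (wOfRecord₉ F N (Θ.liveRepin F N).toStage9Params) (Θ.liveRepin F N).ppSel P (gOfRecord₁₀ F N (Θ.liveRepin F N).toStage9Params P) (lam.kSel P)) s' V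
          ∂(fieldMeasure (F.P P.K) (lam.kSel P + 1) (SU N)) :=
  fibreWitness_of_idem _ _ (ppSel_liveRepin_succ_idem Θ P _ (lam.kSel P)) hmassSel

/-- **BELOW THE TORUS, AT THE LIVE RE-PIN WITH ITS STAGE-10 PROVISOS, N12's MASS DISPLAY ⟺ «every LIVE pre-𝐑 term has positive mass»** — K0b's
`exists_live_slotsTOfRecord_succ_rterm` gives a live sequence at level `k+1 ≤ K`, so the live selector's range IS the live set (§1); the provisos AT THE RE-PIN are displayed
(their tower clauses read the selector — K0′'s content there). [cite: Balaban1989LargeFieldI, (0.3) p.176, p.176 ll.14–16, p.177; Balaban1988Convergent, (3.22)–(3.25) pp.269–270] -/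
theorem massSel_liveRepin_iff (hP : (Θ.liveRepin F N).toStage9Params.Provisos₁₀) (P : B12.RunParams) {k : ℕ} (hk : k < P.K) :
    (∀ s, 0 < ∫ V, rterm (repTOfRecord9 F N Θ.ν Θ.τ9 (EOfRecord₁₀ F N (Θ.liveRepin F N).toStage9Params) (wOfRecord₉ F N (Θ.liveRepin F N).toStage9Params)
        (Θ.liveRepin F N).ppSel P (gOfRecord₁₀ F N (Θ.liveRepin F N).toStage9Params P) k)
        ((Θ.liveRepin F N).ppSel P (gOfRecord₁₀ F N (Θ.liveRepin F N).toStage9Params P) (k + 1) s) V ∂(fieldMeasure (F.P P.K) (k + 1) (SU N))) ↔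
      ∀ s, LiveSeq F N Θ.ν Θ.τ9 P (gOfRecord₁₀ F N (Θ.liveRepin F N).toStage9Params P) (k + 1)
          (slotsTOfRecord F N Θ.ν Θ.τ9 (EOfRecord₁₀ F N (Θ.liveRepin F N).toStage9Params) (wOfRecord₉ F N (Θ.liveRepin F N).toStage9Params)
            (Θ.liveRepin F N).ppSel P (gOfRecord₁₀ F N (Θ.liveRepin F N).toStage9Params P) (k + 1)) s →
        0 < ∫ V, rterm (repTOfRecord9 F N Θ.ν Θ.τ9 (EOfRecord₁₀ F N (Θ.liveRepin F N).toStage9Params) (wOfRecord₉ F N (Θ.liveRepin F N).toStage9Params)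
          (Θ.liveRepin F N).ppSel P (gOfRecord₁₀ F N (Θ.liveRepin F N).toStage9Params P) k) s V ∂(fieldMeasure (F.P P.K) (k + 1) (SU N)) := by
  obtain ⟨s₀, V₀, hT, hI⟩ := exists_live_slotsTOfRecord_succ_rterm F N (Θ.liveRepin F N).toStage9Params P hP k hk
  have hex : ∃ s, LiveSeq F N Θ.ν Θ.τ9 P (gOfRecord₁₀ F N (Θ.liveRepin F N).toStage9Params P) (k + 1)
      (slotsTOfRecord F N Θ.ν Θ.τ9 (EOfRecord₁₀ F N (Θ.liveRepin F N).toStage9Params) (wOfRecord₉ F N (Θ.liveRepin F N).toStage9Params)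
        (Θ.liveRepin F N).ppSel P (gOfRecord₁₀ F N (Θ.liveRepin F N).toStage9Params P) (k + 1)) s :=
    ⟨s₀, liveSeq_of_ne_zero _ s₀ hT hI⟩
  exact forall_mass_pos_ppSelLive_iff (EOfRecord₁₀ F N Θ.toStage9Params) (wOfRecord₉ F N Θ.toStage9Params) P _ k hex _ _

variable (σ : ∀ P : B12.RunParams, Sit189 F N P.K) (p₁ : ℕ)

/-- **THE [IV] LEAF AT THE LIVE RE-PIN'S BUNDLE OF RECORD, fully-lettered layer `λ⁴`, EVERY RUN — `hfib` DROPPED** (module 1's `b15Leaf_WOfRecord₁₀_pinAllχ₀_of_deg_massSel` at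
`(Θ.liveRepin).toStage9Params`, the fibre witness supplied by `fibreWitness_liveRepin_of_massSel`).  Displayed: the Stage-10 provisos at the re-pin, the degenerate-run support
provisos, `hmassSel`, Prop. 1 at `λ.LF P`, (1.80) ∕ (1.89) at `λ⁴`'s letters. [cite: Balaban1989LargeFieldI, (0.2)–(0.6) p.176, p.176 ll.14–16, p.177, Prop. 1 (1.78) p.194, (1.80) p.195, (1.89) p.198, (1.99)–(1.102) pp.200–201] -/
theorem b15Leaf_WOfRecord₁₀_pinAllχ₀_liveRepin_of_deg_massSel (hP : (Θ.liveRepin F N).toStage9Params.Provisos₁₀) {P : B12.RunParams}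
    (hdeg : P.K ≤ lam.kSel P →
      (repDataOfSel (repTOfRecord9 F N Θ.ν Θ.τ9 (EOfRecord₁₀ F N (Θ.liveRepin F N).toStage9Params) (wOfRecord₉ F N (Θ.liveRepin F N).toStage9Params)
          (Θ.liveRepin F N).ppSel P (gOfRecord₁₀ F N (Θ.liveRepin F N).toStage9Params P) (lam.kSel P))
        ((Θ.liveRepin F N).ppSel P (gOfRecord₁₀ F N (Θ.liveRepin F N).toStage9Params P) (lam.kSel P + 1))
        (fibOfSeq F Θ.ν Θ.τ9 P (gOfRecord₁₀ F N (Θ.liveRepin F N).toStage9Params P) (lam.kSel P + 1))).ProvisosSupp)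
    (hmassSel : ∀ s, 0 < ∫ V, rterm (repTOfRecord9 F N Θ.ν Θ.τ9 (EOfRecord₁₀ F N (Θ.liveRepin F N).toStage9Params)
        (wOfRecord₉ F N (Θ.liveRepin F N).toStage9Params) (Θ.liveRepin F N).ppSel P (gOfRecord₁₀ F N (Θ.liveRepin F N).toStage9Params P) (lam.kSel P))
        ((Θ.liveRepin F N).ppSel P (gOfRecord₁₀ F N (Θ.liveRepin F N).toStage9Params P) (lam.kSel P + 1) s) V ∂(fieldMeasure (F.P P.K) (lam.kSel P + 1) (SU N)))
    (hP1 : Prop1Printed (lam.LF P))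
    (h180 : ∀ U, new189 (((lam.pinRPrime (Θ.liveRepin F N).toStage9Params).pinD189χ₀ (Θ.liveRepin F N).toStage9Params σ p₁).D189 P) U →
      ∀ i, (((lam.pinRPrime (Θ.liveRepin F N).toStage9Params).pinD189χ₀ (Θ.liveRepin F N).toStage9Params σ p₁).D189 P).h ≤ i →
        i ≤ (((lam.pinRPrime (Θ.liveRepin F N).toStage9Params).pinD189χ₀ (Θ.liveRepin F N).toStage9Params σ p₁).D189 P).k →
          ∀ q ∈ plaqsOf (dom (((lam.pinRPrime (Θ.liveRepin F N).toStage9Params).pinD189χ₀ (Θ.liveRepin F N).toStage9Params σ p₁).D189 P) i),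
            Ineq180 ((((lam.pinRPrime (Θ.liveRepin F N).toStage9Params).pinD189χ₀ (Θ.liveRepin F N).toStage9Params σ p₁).D189 P).dev0 U q)
              ((((lam.pinRPrime (Θ.liveRepin F N).toStage9Params).pinD189χ₀ (Θ.liveRepin F N).toStage9Params σ p₁).D189 P).ε
                (((lam.pinRPrime (Θ.liveRepin F N).toStage9Params).pinD189χ₀ (Θ.liveRepin F N).toStage9Params σ p₁).D189 P).k)
              (((lam.pinRPrime (Θ.liveRepin F N).toStage9Params).pinD189χ₀ (Θ.liveRepin F N).toStage9Params σ p₁).D189 P).η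
              (σ P).B₃ (σ P).B₅ (σ P).M (σ P).δ ((σ P).dist q) (σ P).O1)
    (h189 : Claim189 (new189 (((lam.pinRPrime (Θ.liveRepin F N).toStage9Params).pinD189χ₀ (Θ.liveRepin F N).toStage9Params σ p₁).D189 P))
      (chiPP (((lam.pinRPrime (Θ.liveRepin F N).toStage9Params).pinD189χ₀ (Θ.liveRepin F N).toStage9Params σ p₁).D189 P))) :
    B15Leaf (WOfRecord₁₀ F N (Θ.liveRepin F N).toStage9Params
      ((lam.pinRPrime (Θ.liveRepin F N).toStage9Params).pinD189χ₀ (Θ.liveRepin F N).toStage9Params σ p₁) P) :=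
  b15Leaf_WOfRecord₁₀_pinAllχ₀_of_deg_massSel σ p₁ hP hdeg hmassSel (fibreWitness_liveRepin_of_massSel Θ lam P hmassSel) hP1 h180 h189

/-- **BELOW THE TORUS, THE SAME LEAF ON PRINT's RESIDUAL PROVISO IN ITS HONEST FORM**: for a run whose step `λ.kSel P < K`, the leaf at the live re-pin's bundle of record from
the Stage-10 provisos at the re-pin, POSITIVE MASS OF THE LIVE pre-𝐑 TERMS at that step (`hmassLive`), Prop. 1, (1.80), (1.89) — no `hfib`, no `hdeg`, no selector in the mass
proviso. [cite: Balaban1989LargeFieldI, (0.2)–(0.6) p.176, p.176 ll.14–16, p.177, Prop. 1 (1.78) p.194, (1.80) p.195, (1.89) p.198] -/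
theorem b15Leaf_WOfRecord₁₀_pinAllχ₀_liveRepin_of_massLive (hP : (Θ.liveRepin F N).toStage9Params.Provisos₁₀) {P : B12.RunParams} (hK : lam.kSel P < P.K)
    (hmassLive : ∀ s, LiveSeq F N Θ.ν Θ.τ9 P (gOfRecord₁₀ F N (Θ.liveRepin F N).toStage9Params P) (lam.kSel P + 1)
        (slotsTOfRecord F N Θ.ν Θ.τ9 (EOfRecord₁₀ F N (Θ.liveRepin F N).toStage9Params) (wOfRecord₉ F N (Θ.liveRepin F N).toStage9Params)
          (Θ.liveRepin F N).ppSel P (gOfRecord₁₀ F N (Θ.liveRepin F N).toStage9Params P) (lam.kSel P + 1)) s →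
      0 < ∫ V, rterm (repTOfRecord9 F N Θ.ν Θ.τ9 (EOfRecord₁₀ F N (Θ.liveRepin F N).toStage9Params) (wOfRecord₉ F N (Θ.liveRepin F N).toStage9Params)
        (Θ.liveRepin F N).ppSel P (gOfRecord₁₀ F N (Θ.liveRepin F N).toStage9Params P) (lam.kSel P)) s V ∂(fieldMeasure (F.P P.K) (lam.kSel P + 1) (SU N)))
    (hP1 : Prop1Printed (lam.LF P))
    (h180 : ∀ U, new189 (((lam.pinRPrime (Θ.liveRepin F N).toStage9Params).pinD189χ₀ (Θ.liveRepin F N).toStage9Params σ p₁).D189 P) U →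
      ∀ i, (((lam.pinRPrime (Θ.liveRepin F N).toStage9Params).pinD189χ₀ (Θ.liveRepin F N).toStage9Params σ p₁).D189 P).h ≤ i →
        i ≤ (((lam.pinRPrime (Θ.liveRepin F N).toStage9Params).pinD189χ₀ (Θ.liveRepin F N).toStage9Params σ p₁).D189 P).k →
          ∀ q ∈ plaqsOf (dom (((lam.pinRPrime (Θ.liveRepin F N).toStage9Params).pinD189χ₀ (Θ.liveRepin F N).toStage9Params σ p₁).D189 P) i),
            Ineq180 ((((lam.pinRPrime (Θ.liveRepin F N).toStage9Params).pinD189χ₀ (Θ.liveRepin F N).toStage9Params σ p₁).D189 P).dev0 U q)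
              ((((lam.pinRPrime (Θ.liveRepin F N).toStage9Params).pinD189χ₀ (Θ.liveRepin F N).toStage9Params σ p₁).D189 P).ε
                (((lam.pinRPrime (Θ.liveRepin F N).toStage9Params).pinD189χ₀ (Θ.liveRepin F N).toStage9Params σ p₁).D189 P).k)
              (((lam.pinRPrime (Θ.liveRepin F N).toStage9Params).pinD189χ₀ (Θ.liveRepin F N).toStage9Params σ p₁).D189 P).η
              (σ P).B₃ (σ P).B₅ (σ P).M (σ P).δ ((σ P).dist q) (σ P).O1)
    (h189 : Claim189 (new189 (((lam.pinRPrime (Θ.liveRepin F N).toStage9Params).pinD189χ₀ (Θ.liveRepin F N).toStage9Params σ p₁).D189 P))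
      (chiPP (((lam.pinRPrime (Θ.liveRepin F N).toStage9Params).pinD189χ₀ (Θ.liveRepin F N).toStage9Params σ p₁).D189 P))) :
    B15Leaf (WOfRecord₁₀ F N (Θ.liveRepin F N).toStage9Params
      ((lam.pinRPrime (Θ.liveRepin F N).toStage9Params).pinD189χ₀ (Θ.liveRepin F N).toStage9Params σ p₁) P) :=
  b15Leaf_WOfRecord₁₀_pinAllχ₀_liveRepin_of_deg_massSel Θ lam σ p₁ hP (fun hK' => absurd hK (not_lt.mpr hK'))
    ((massSel_liveRepin_iff Θ hP P hK).mpr hmassLive) hP1 h180 h189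

/-- **N12's POINTED ROW AT THE LIVE RE-PIN, READ AT ITS BUNDLE OF RECORD, BELOW THE TORUS** (module 1 §4 at `Θ.liveRepin`: the W-pin keeps guard ∕ provisos ∕ admissibility ∕
datum; the live re-pin keeps everything but the selector).  Displayed: Stage-10 provisos at the re-pin, positive mass of the live terms, Prop. 1, (1.80), (1.89).
[cite: Balaban1989LargeFieldI, (0.2)–(0.6) p.176, p.176 ll.14–16, Prop. 1 (1.78) p.194, (1.80) p.195, (1.89) p.198] -/
theorem b15Leaf_res_W_pinW_liveRepin_of_massLive (hP : (Θ.liveRepin F N).toStage9Params.Provisos₁₀) {P : B12.RunParams} (hK : lam.kSel P < P.K)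
    (hmassLive : ∀ s, LiveSeq F N Θ.ν Θ.τ9 P (gOfRecord₁₀ F N (Θ.liveRepin F N).toStage9Params P) (lam.kSel P + 1)
        (slotsTOfRecord F N Θ.ν Θ.τ9 (EOfRecord₁₀ F N (Θ.liveRepin F N).toStage9Params) (wOfRecord₉ F N (Θ.liveRepin F N).toStage9Params)
          (Θ.liveRepin F N).ppSel P (gOfRecord₁₀ F N (Θ.liveRepin F N).toStage9Params P) (lam.kSel P + 1)) s →
      0 < ∫ V, rterm (repTOfRecord9 F N Θ.ν Θ.τ9 (EOfRecord₁₀ F N (Θ.liveRepin F N).toStage9Params) (wOfRecord₉ F N (Θ.liveRepin F N).toStage9Params)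
        (Θ.liveRepin F N).ppSel P (gOfRecord₁₀ F N (Θ.liveRepin F N).toStage9Params P) (lam.kSel P)) s V ∂(fieldMeasure (F.P P.K) (lam.kSel P + 1) (SU N)))
    (hP1 : Prop1Printed (lam.LF P))
    (h180 : ∀ U, new189 (((lam.pinRPrime (Θ.liveRepin F N).toStage9Params).pinD189χ₀ (Θ.liveRepin F N).toStage9Params σ p₁).D189 P) U →
      ∀ i, (((lam.pinRPrime (Θ.liveRepin F N).toStage9Params).pinD189χ₀ (Θ.liveRepin F N).toStage9Params σ p₁).D189 P).h ≤ i →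
        i ≤ (((lam.pinRPrime (Θ.liveRepin F N).toStage9Params).pinD189χ₀ (Θ.liveRepin F N).toStage9Params σ p₁).D189 P).k →
          ∀ q ∈ plaqsOf (dom (((lam.pinRPrime (Θ.liveRepin F N).toStage9Params).pinD189χ₀ (Θ.liveRepin F N).toStage9Params σ p₁).D189 P) i),
            Ineq180 ((((lam.pinRPrime (Θ.liveRepin F N).toStage9Params).pinD189χ₀ (Θ.liveRepin F N).toStage9Params σ p₁).D189 P).dev0 U q)
              ((((lam.pinRPrime (Θ.liveRepin F N).toStage9Params).pinD189χ₀ (Θ.liveRepin F N).toStage9Params σ p₁).D189 P).ε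
                (((lam.pinRPrime (Θ.liveRepin F N).toStage9Params).pinD189χ₀ (Θ.liveRepin F N).toStage9Params σ p₁).D189 P).k)
              (((lam.pinRPrime (Θ.liveRepin F N).toStage9Params).pinD189χ₀ (Θ.liveRepin F N).toStage9Params σ p₁).D189 P).η
              (σ P).B₃ (σ P).B₅ (σ P).M (σ P).δ ((σ P).dist q) (σ P).O1)
    (h189 : Claim189 (new189 (((lam.pinRPrime (Θ.liveRepin F N).toStage9Params).pinD189χ₀ (Θ.liveRepin F N).toStage9Params σ p₁).D189 P))
      (chiPP (((lam.pinRPrime (Θ.liveRepin F N).toStage9Params).pinD189χ₀ (Θ.liveRepin F N).toStage9Params σ p₁).D189 P))) :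
    B15Leaf (((Θ.liveRepin F N).pinW F N (WOfRecord₁₂ F N (Θ.liveRepin F N)
      ((lam.pinRPrime (Θ.liveRepin F N).toStage9Params).pinD189χ₀ (Θ.liveRepin F N).toStage9Params σ p₁))).res.W P) :=
  b15Leaf_WOfRecord₁₀_pinAllχ₀_liveRepin_of_massLive Θ lam σ p₁ hP hK hmassLive hP1 h180 h189

end Repin

/-! ## §4 ON THE K0′ WITNESS LINE `θ₀ˡⁱᵛᵉ := theta12LiveOfRecord F N ζ Rz Zt` (`= (theta12OfRecord …).liveRepin`, K0a `rfl`) -/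

section Theta
variable (ζ : ZetaOfRecord F N numerics7OfRecord₁₂ 1) (Rz : (K : ℕ) → Sect2.Residual (F.P K) (MatA N)) (Zt : (K : ℕ) → TkResidualW F N (FluctV N) K)
  (lam : ResidW F N) (σ : ∀ P : B12.RunParams, Sit189 F N P.K) (p₁ : ℕ)

/-- **AT `θ₀ˡⁱᵛᵉ` THE (1.80) ∕ (1.89) DISPLAYS AT `λ⁴` ARE NEVER VACUOUS ON A RUN IN THE WINDOW — ADMISSIBILITY DISCHARGED** (K0a's hypothesis-free
`admissible_theta12LiveOfRecord`; module 1's `new189_pinAllχ₀_one_zero₁₂`; the window is `]0, ½]`: `θ₀ˡⁱᵛᵉ.γ = 1∕2`, `θ₀ˡⁱᵛᵉ.A₁ = 1`, K0a `rfl`).  The remaining inputs are the run's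
history in the window up to `n` and the situation's levels `h ≤ k ≤ n`. [cite: Balaban1989LargeFieldI, (1.82) p.196, (1.89) p.198, p.183; Balaban1988Convergent, (2.4) p.255, (2.12) p.256; Balaban1987RG1, Thm 1 p.255] -/
theorem new189_pinAllχ₀_one_zero_theta12Live (P : B12.RunParams) {n : ℕ}
    (hI : Step.InInterval (theta12LiveOfRecord F N ζ Rz Zt).γ n (gOfRecord₁₀ F N (theta12LiveOfRecord F N ζ Rz Zt).toStage9Params P))
    (hhk : (σ P).h ≤ (σ P).k) (hkn : (σ P).k ≤ n) :
    new189 (((lam.pinRPrime (theta12LiveOfRecord F N ζ Rz Zt).toStage9Params).pinD189χ₀ (theta12LiveOfRecord F N ζ Rz Zt).toStage9Params σ p₁).D189 P)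
      ((1 : MSField (F.P P.K) (SU N)), fun _ _ => (0 : EuclideanSpace ℝ (Fin (N ^ 2 - 1)))) :=
  new189_pinAllχ₀_one_zero₁₂ (theta12LiveOfRecord F N ζ Rz Zt) lam σ p₁ (admissible_theta12LiveOfRecord F N ζ Rz Zt) P hI hhk hkn

/-- **N12's POINTED ROW ON THE K0′ WITNESS LINE, BELOW THE TORUS** — at `θ₀ˡⁱᵛᵉ.pinW (WOfRecord₁₂ θ₀ˡⁱᵛᵉ λ⁴)` the row `B15Leaf ((…).res.W P)` holds from: the Stage-10 provisos
AT `θ₀ˡⁱᵛᵉ` (K0′'s `Provisos₁₂.base` there — displayed), POSITIVE MASS OF THE LIVE pre-𝐑 TERMS at step `λ.kSel P < K` (NODE 00), Prop. 1 at `λ.LF P` (dag-n12-c), (1.80) + (1.89) at the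
pinned letters (dag-n12-e) — no fibre witness, no selector in the mass proviso (§3 `b15Leaf_res_W_pinW_liveRepin_of_massLive` at `Θ := theta12OfRecord …`).  Feed it as `h12` to
module 1's `nodesAtSomeRecord₁₂_of_pointed_pinW (θ := θ₀ˡⁱᵛᵉ)` with `hθ := admissible_theta12LiveOfRecord`, guard `ztUnity_theta12LiveOfRecord` (K0b's residuals of record) ∧
`slotsNondegenerate_theta12LiveOfRecord_of_live` (per-level liveness) — the `stub_nodes12` body on the witness line.  NOT a discharge. [cite: Balaban1989LargeFieldI, (0.2)–(0.6) p.176, p.176 ll.14–16, p.177, Prop. 1 (1.78) p.194, (1.80) p.195, (1.89) p.198; Balaban1989LargeFieldII, Thm 1 + (0.1) pp.355–356 (bookkeeping)] -/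
theorem b15Leaf_res_W_pinW_theta12Live_of_massLive
    (hP : (theta12LiveOfRecord F N ζ Rz Zt).toStage9Params.Provisos₁₀) {P : B12.RunParams} (hK : lam.kSel P < P.K)
    (hmassLive : ∀ s, LiveSeq F N numerics7OfRecord₁₂ towerNumericsOfRecord₁₂ P (gOfRecord₁₀ F N (theta12LiveOfRecord F N ζ Rz Zt).toStage9Params P) (lam.kSel P + 1)
        (slotsTOfRecord F N numerics7OfRecord₁₂ towerNumericsOfRecord₁₂ (EOfRecord₁₀ F N (theta12LiveOfRecord F N ζ Rz Zt).toStage9Params)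
          (wOfRecord₉ F N (theta12LiveOfRecord F N ζ Rz Zt).toStage9Params) (theta12LiveOfRecord F N ζ Rz Zt).ppSel P
          (gOfRecord₁₀ F N (theta12LiveOfRecord F N ζ Rz Zt).toStage9Params P) (lam.kSel P + 1)) s →
      0 < ∫ V, rterm (repTOfRecord9 F N numerics7OfRecord₁₂ towerNumericsOfRecord₁₂ (EOfRecord₁₀ F N (theta12LiveOfRecord F N ζ Rz Zt).toStage9Params)
        (wOfRecord₉ F N (theta12LiveOfRecord F N ζ Rz Zt).toStage9Params) (theta12LiveOfRecord F N ζ Rz Zt).ppSel P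
        (gOfRecord₁₀ F N (theta12LiveOfRecord F N ζ Rz Zt).toStage9Params P) (lam.kSel P)) s V ∂(fieldMeasure (F.P P.K) (lam.kSel P + 1) (SU N)))
    (hP1 : Prop1Printed (lam.LF P))
    (h180 : ∀ U, new189 (((lam.pinRPrime (theta12LiveOfRecord F N ζ Rz Zt).toStage9Params).pinD189χ₀ (theta12LiveOfRecord F N ζ Rz Zt).toStage9Params σ p₁).D189 P) U →
      ∀ i, (((lam.pinRPrime (theta12LiveOfRecord F N ζ Rz Zt).toStage9Params).pinD189χ₀ (theta12LiveOfRecord F N ζ Rz Zt).toStage9Params σ p₁).D189 P).h ≤ i →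
        i ≤ (((lam.pinRPrime (theta12LiveOfRecord F N ζ Rz Zt).toStage9Params).pinD189χ₀ (theta12LiveOfRecord F N ζ Rz Zt).toStage9Params σ p₁).D189 P).k →
          ∀ q ∈ plaqsOf (dom (((lam.pinRPrime (theta12LiveOfRecord F N ζ Rz Zt).toStage9Params).pinD189χ₀ (theta12LiveOfRecord F N ζ Rz Zt).toStage9Params σ p₁).D189 P) i),
            Ineq180 ((((lam.pinRPrime (theta12LiveOfRecord F N ζ Rz Zt).toStage9Params).pinD189χ₀ (theta12LiveOfRecord F N ζ Rz Zt).toStage9Params σ p₁).D189 P).dev0 U q)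
              ((((lam.pinRPrime (theta12LiveOfRecord F N ζ Rz Zt).toStage9Params).pinD189χ₀ (theta12LiveOfRecord F N ζ Rz Zt).toStage9Params σ p₁).D189 P).ε
                (((lam.pinRPrime (theta12LiveOfRecord F N ζ Rz Zt).toStage9Params).pinD189χ₀ (theta12LiveOfRecord F N ζ Rz Zt).toStage9Params σ p₁).D189 P).k)
              (((lam.pinRPrime (theta12LiveOfRecord F N ζ Rz Zt).toStage9Params).pinD189χ₀ (theta12LiveOfRecord F N ζ Rz Zt).toStage9Params σ p₁).D189 P).η
              (σ P).B₃ (σ P).B₅ (σ P).M (σ P).δ ((σ P).dist q) (σ P).O1)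
    (h189 : Claim189 (new189 (((lam.pinRPrime (theta12LiveOfRecord F N ζ Rz Zt).toStage9Params).pinD189χ₀ (theta12LiveOfRecord F N ζ Rz Zt).toStage9Params σ p₁).D189 P))
      (chiPP (((lam.pinRPrime (theta12LiveOfRecord F N ζ Rz Zt).toStage9Params).pinD189χ₀ (theta12LiveOfRecord F N ζ Rz Zt).toStage9Params σ p₁).D189 P))) :
    B15Leaf (((theta12LiveOfRecord F N ζ Rz Zt).pinW F N (WOfRecord₁₂ F N (theta12LiveOfRecord F N ζ Rz Zt)
      ((lam.pinRPrime (theta12LiveOfRecord F N ζ Rz Zt).toStage9Params).pinD189χ₀ (theta12LiveOfRecord F N ζ Rz Zt).toStage9Params σ p₁))).res.W P) :=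
  b15Leaf_res_W_pinW_liveRepin_of_massLive (theta12OfRecord F N ζ Rz Zt) lam σ p₁ hP hK hmassLive hP1 h180 h189

end Theta

/-! ## §5 THE `NodesAtSomeRecord12` BODY AT A LIVE RE-PIN WITH N12's ROW AT THE BUNDLE OF RECORD — `hfib` gone (module 1 §5 at `Θ.liveRepin`) -/

section Body
variable (Θ : Stage12Params F N) (hP : (Θ.liveRepin F N).Provisos₁₂ F N) (lam : ResidW F N) (σ : ∀ P : B12.RunParams, Sit189 F N P.K) (p₁ : ℕ)

/-- **THE BODY OF `NodesAtSomeRecord12` AT THE LIVE RE-PIN `Θ.liveRepin`, N12 READ AT ITS BUNDLE OF RECORD WITH EVERY CONSTRUCTIBLE LETTER PINNED** — module 1's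
`nodesAtSomeRecord₁₂_of_pointed_pinW` at `θ := Θ.liveRepin`: admissibility and print's partition of unity are Θ's (K0a's `Admissible.liveRepin`, `ZtUnity.liveRepin` — the re-pin
touches only the selector), `SlotsNondegenerate` AT THE RE-PIN (`hnd`; = per-level liveness, K0a's `slotsNondegenerate_liveRepin_iff`) and `Provisos₁₂` AT THE RE-PIN (`hP`) DISPLAYED
(K0′'s rows), rows N05–N10 at Θ's residual carriers verbatim, N11 ∕ N13 at the re-pin's §2 laws, the Cor.-3 leaves at the re-pin's datum, and N12 := `hdeg`, `hmassSel`, Prop. 1,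
(1.80), (1.89) at `λ⁴` — NO fibre witness (§3).  On the witness line take `Θ := theta12OfRecord F N ζ Rz Zt` (`hθ := admissible_theta12OfRecord`, `hzt` = K0b's at the residuals
of record).  COMPOSITE; NOT a discharge; count-neutral. [cite: Balaban1989LargeFieldII, Thm 1 p.355 + p.391; Balaban1989LargeFieldI, (0.2)–(0.6) p.176, p.177, Prop. 1 (1.78) p.194, (1.80) p.195, (1.89) p.198; Balaban1988Convergent, (3.16)–(3.22) pp.268–269 (bookkeeping: the stub's body on the live re-pin)] -/
theorem nodesAtSomeRecord₁₂_of_pointed_liveRepin_pinW_of_massSel (hθ : Θ.Admissible F N) (hzt : Θ.ZtUnity F N) (hnd : (Θ.liveRepin F N).SlotsNondegenerate)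
    (w : WorldP) (hC : w.C = (datumOfRecord₁₂ F N (Θ.liveRepin F N) hP).C) (hγ : 0 < w.γ ∧ w.γ ≤ Θ.γ) (hL : w.L = (Θ.L : ℝ))
    (hup : ∀ P, w.up P = upOfRecord₅C F N (((Θ.liveRepin F N).pinW F N (WOfRecord₁₂ F N (Θ.liveRepin F N)
      ((lam.pinRPrime (Θ.liveRepin F N).toStage9Params).pinD189χ₀ (Θ.liveRepin F N).toStage9Params σ p₁))).toStage5₁₂ F N) P)
    (h05 : ∀ P : B12.RunParams,
      B8LeafR (Θ.res.X P).d8 (Θ.res.X P).L8 (Θ.res.X P).C₂ (Θ.res.X P).B₁' (Θ.res.X P).B₀' (Θ.res.X P).B₁ (Θ.res.X P).B₂ (Θ.res.X P).c₁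
        (Θ.res.X P).inp8 (Θ.res.X P).B₀β (Θ.res.X P).loc8 (Θ.res.X P).fam8R (Θ.res.X P).lan8 (Θ.res.X P).cub8 (Θ.res.X P).toAxial8)
    (h06 : ∀ P : B12.RunParams, B9LeafX (Θ.res.Y P))
    (h07 : ∀ P : B12.RunParams, B11Leaf (Θ.res.Z P))
    (h08 : ∀ P : B12.RunParams, ∃ (Xc : PrintedCarriersR) (I : Type) (C : B10Assembly.Consts) (T : I → B10.TowerRun),
      Nonempty (∀ i, B10Assembly.LeafSystem C (T i)) ∧ Θ.res.X P = Xc.withTowerRuns10 T)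
    (h09 : ∀ P : B12.RunParams, B12Sec2to5.Lemma4Printed (Θ.res.X P).F12 (Θ.res.X P).c12)
    (h09T : ∀ P : B12.RunParams, (leavesP w P).smallCouplings → (leavesP w P).smallFieldInductive)
    (h10 : ∀ P : B12.RunParams, B9LeafX (Θ.res.Y P) →
      (B10.Thm1PrintedCompact (Θ.res.X P).runs10 ∧ B10.Thm2Printed (Θ.res.X P).runs10) →
        B11Leaf (Θ.res.Z P) → B12Sec2to5.Lemma4Printed (Θ.res.X P).F12 (Θ.res.X P).c12 →
          B13.Lemma1Printed (Θ.res.X P).S13 (Θ.res.X P).c13 ∧ B13.Lemma2Printed (Θ.res.X P).S13 (Θ.res.X P).c13 ∧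
            B13.Lemma3Printed (Θ.res.X P).S13 (Θ.res.X P).c13)
    (h11 : ∀ P : B12.RunParams, (leavesP w P).b7 → (leavesP w P).b8 → (leavesP w P).b9 → (leavesP w P).b10 → (leavesP w P).b11 →
      (leavesP w P).smallCouplings → (leavesP w P).smallFieldInductive → (leavesP w P).flowControl →
        ∀ k, k < P.K → SLaw₁₂ F N (Θ.liveRepin F N) P k → TLaw₁₂ F N (Θ.liveRepin F N) P k)
    (hN12 : ∀ P : B12.RunParams,
      (P.K ≤ lam.kSel P →
        (repDataOfSel (repTOfRecord9 F N Θ.ν Θ.τ9 (EOfRecord₁₀ F N (Θ.liveRepin F N).toStage9Params) (wOfRecord₉ F N (Θ.liveRepin F N).toStage9Params)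
            (Θ.liveRepin F N).ppSel P (gOfRecord₁₀ F N (Θ.liveRepin F N).toStage9Params P) (lam.kSel P))
          ((Θ.liveRepin F N).ppSel P (gOfRecord₁₀ F N (Θ.liveRepin F N).toStage9Params P) (lam.kSel P + 1))
          (fibOfSeq F Θ.ν Θ.τ9 P (gOfRecord₁₀ F N (Θ.liveRepin F N).toStage9Params P) (lam.kSel P + 1))).ProvisosSupp) ∧
      (∀ s, 0 < ∫ V, rterm (repTOfRecord9 F N Θ.ν Θ.τ9 (EOfRecord₁₀ F N (Θ.liveRepin F N).toStage9Params) (wOfRecord₉ F N (Θ.liveRepin F N).toStage9Params)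
        (Θ.liveRepin F N).ppSel P (gOfRecord₁₀ F N (Θ.liveRepin F N).toStage9Params P) (lam.kSel P))
        ((Θ.liveRepin F N).ppSel P (gOfRecord₁₀ F N (Θ.liveRepin F N).toStage9Params P) (lam.kSel P + 1) s) V ∂(fieldMeasure (F.P P.K) (lam.kSel P + 1) (SU N))) ∧
      Prop1Printed (lam.LF P) ∧
      (∀ U, new189 (((lam.pinRPrime (Θ.liveRepin F N).toStage9Params).pinD189χ₀ (Θ.liveRepin F N).toStage9Params σ p₁).D189 P) U →
        ∀ i, (((lam.pinRPrime (Θ.liveRepin F N).toStage9Params).pinD189χ₀ (Θ.liveRepin F N).toStage9Params σ p₁).D189 P).h ≤ i →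
          i ≤ (((lam.pinRPrime (Θ.liveRepin F N).toStage9Params).pinD189χ₀ (Θ.liveRepin F N).toStage9Params σ p₁).D189 P).k →
            ∀ q ∈ plaqsOf (dom (((lam.pinRPrime (Θ.liveRepin F N).toStage9Params).pinD189χ₀ (Θ.liveRepin F N).toStage9Params σ p₁).D189 P) i),
              Ineq180 ((((lam.pinRPrime (Θ.liveRepin F N).toStage9Params).pinD189χ₀ (Θ.liveRepin F N).toStage9Params σ p₁).D189 P).dev0 U q)
                ((((lam.pinRPrime (Θ.liveRepin F N).toStage9Params).pinD189χ₀ (Θ.liveRepin F N).toStage9Params σ p₁).D189 P).ε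
                  (((lam.pinRPrime (Θ.liveRepin F N).toStage9Params).pinD189χ₀ (Θ.liveRepin F N).toStage9Params σ p₁).D189 P).k)
                (((lam.pinRPrime (Θ.liveRepin F N).toStage9Params).pinD189χ₀ (Θ.liveRepin F N).toStage9Params σ p₁).D189 P).η
                (σ P).B₃ (σ P).B₅ (σ P).M (σ P).δ ((σ P).dist q) (σ P).O1) ∧
      Claim189 (new189 (((lam.pinRPrime (Θ.liveRepin F N).toStage9Params).pinD189χ₀ (Θ.liveRepin F N).toStage9Params σ p₁).D189 P))
        (chiPP (((lam.pinRPrime (Θ.liveRepin F N).toStage9Params).pinD189χ₀ (Θ.liveRepin F N).toStage9Params σ p₁).D189 P)))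
    (hR : ∀ (P : B12.RunParams) (k : ℕ), k < P.K → TLaw₁₂ F N (Θ.liveRepin F N) P k → SLaw₁₂ F N (Θ.liveRepin F N) P (k + 1))
    (hcor3 : ∃ R : B14Cor3.ReprFamily (datumOfRecord₁₂ F N (Θ.liveRepin F N) hP).C,
      B14Cor3.LeafH (datumOfRecord₁₂ F N (Θ.liveRepin F N) hP).C R w.γ ∧ B14Cor3.LeafU1 (datumOfRecord₁₂ F N (Θ.liveRepin F N) hP).C R w.γ ∧
        B14Cor3.LeafU2 (datumOfRecord₁₂ F N (Θ.liveRepin F N) hP).C R w.γ w.ep ∧ B14Cor3.LeafL1 (datumOfRecord₁₂ F N (Θ.liveRepin F N) hP).C R w.γ ∧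
          B14Cor3.LeafL2 (datumOfRecord₁₂ F N (Θ.liveRepin F N) hP).C R w.γ w.em) :
    ∃ (θ' : Stage12Params F N) (h' : θ'.Provisos₁₂ F N) (w' : WorldP), (θ'.ZtUnity F N ∧ θ'.SlotsNondegenerate) ∧ θ'.Admissible F N ∧
      IsRecordOfRecord₁₂C F N (datumOfRecord₁₂ F N θ' h') w' ∧ ∀ P : B12.RunParams, Nodes (leavesP w' P) :=
  nodesAtSomeRecord₁₂_of_pointed_pinW (Θ.liveRepin F N) hP hθ.liveRepin ⟨hzt.liveRepin, hnd⟩ _ w hC hγ hL hup h05 h06 h07 h08 h09 h09T h10 h11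
    (fun P => by
      obtain ⟨hdeg, hmassSel, hP1, h180, h189⟩ := hN12 P
      exact b15Leaf_WOfRecord₁₀_pinAllχ₀_liveRepin_of_deg_massSel Θ lam σ p₁ hP.base hdeg hmassSel hP1 h180 h189)
    hR hcor3

end Body

end Summit.QuantumFields.YangMills.BalabanUVNodes.N12AtRecord12LiveSelector

end
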